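import Summits.ResolutionOfSingularities.ResolutionOfSingularities.Theorems.ValuativeLuAlphaPTorsorAbhyankarDefectless
import Summits.ResolutionOfSingularities.ResolutionOfSingularities.Theorems.ValuativeLuAlphaPTorsorTorsorExtension
import HarnessLib

/-!
# `α_p`-torsors along Abhyankar places: the place stays Abhyankar on the base `Frac A₀`

Crux `Valuative.LuAlphaPTorsor` (item `stmt-ResolutionOfSingularities-0641`), line
`pfaff-line-log-final-forms`, registered stub `stub_abhyankarTransfer` (W0).

Setting: `k` a field of characteristic `p`, `K ⊇ k` a field, `O` a valuation ring of `K`,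
`A₀ ⊆ O` a `k`-subalgebra, `t ∈ K` with `t ^ p ∈ A₀` and `Frac (A₀[t]) = K`;
`K₀ := Frac A₀ = Subfield.closure A₀ ⊆ K`.

**Claim.** If `O` is an Abhyankar place of `K/k` in the ambient rendering
(`IsAbhyankarPlace O (im k) ⊤`), then its restriction to `K₀` is an Abhyankar place of `K₀/k`
(`IsAbhyankarPlace O (im k) K₀`).

Proof. In characteristic `p`, `K^p ⊆ K₀` (`torsor_pow_mem_adjoin`: Frobenius maps `A₀[t]` into
`A₀`). Take Abhyankar data `(x, y)` of `K/k`: `x` non-zero with `ℤ`-independent values modulo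
`v(k)`, `y ∈ O` with residues algebraically independent over the residue field of `k`, `K`
algebraic over `k(x, y)`. The `p`-th powers `(x^p, y^p)` lie in `K₀`, their values
`p · v(xᵢ)` are still `ℤ`-independent, their residues `(yⱼP)^p` are still algebraically
independent (`AlgebraicIndependent.polynomial_aeval_of_transcendental` with `X ^ p`), and `K`
(a fortiori `K₀`) is algebraic over `k(x^p, y^p)`, since `k(x, y)` is generated over
`k(x^p, y^p)` by `p`-th roots. Conclude with `isAbhyankarPlace_of_algebraic`.
-/

-- single-problem summit: the doubled namespace component `ResolutionOfSingularities` is forced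
set_option linter.dupNamespace false

namespace Summit.ResolutionOfSingularities.ResolutionOfSingularities.Theorems.PfaffLine

open IsLocalRing Literature.AlgebraicGeometry.Resolution

/-! ### `p`-th powers of Abhyankar data -/

/-- **Values of `p`-th powers stay `ℤ`-independent.** If the values of `x₁, …, x_ρ` are
`ℤ`-linearly independent modulo `vK` and `n ≠ 0`, then so are the values of `x₁ ^ n, …, x_ρ ^ n`
(`∏ v(xᵢ ^ n)^{mᵢ} = ∏ v(xᵢ)^{n mᵢ}`). [folklore] -/
theorem abhTransfer_valIndep_pow {K : Type} [Field K] (O : ValuationSubring K) (kK : Subfield K)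
    {ρ : ℕ} (x : Fin ρ → K) {n : ℕ} (hn : n ≠ 0)
    (hvi : ∀ m : Fin ρ → ℤ,
      (∃ b ∈ kK, (∏ i, O.valuation (x i) ^ (m i)) = O.valuation b) → m = 0) :
    ∀ m : Fin ρ → ℤ,
      (∃ b ∈ kK, (∏ i, O.valuation (x i ^ n) ^ (m i)) = O.valuation b) → m = 0 := by
  rintro m ⟨b, hb, heq⟩
  have heq' : (∏ i, O.valuation (x i) ^ ((n : ℤ) * m i)) = O.valuation b := by
    rw [← heq]
    refine Finset.prod_congr rfl fun i _ => ?_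
    rw [zpow_mul, zpow_natCast, map_pow]
  have h := hvi (fun i => (n : ℤ) * m i) ⟨b, hb, heq'⟩
  funext i
  have hi : (n : ℤ) * m i = 0 := congr_fun h i
  exact (mul_eq_zero.mp hi).resolve_left (by exact_mod_cast hn)

/-- **Residues of `p`-th powers stay algebraically independent.** If the residues of
`y₁, …, y_τ ∈ O` are algebraically independent over a subfield `κ₀` of the residue field, then so
are the residues of `y₁ ^ n, …, y_τ ^ n` for `0 < n` (substitute `X ^ n`, a transcendental
polynomial). [folklore] -/
theorem abhTransfer_algIndep_residue_pow {K : Type} [Field K] (O : ValuationSubring K)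
    (κ₀ : Subfield (ResidueField O)) {τ : ℕ} (y : Fin τ → K) (hy : ∀ j, y j ∈ O) {n : ℕ}
    (hn : 0 < n) (hyn : ∀ j, y j ^ n ∈ O)
    (hri : AlgebraicIndependent κ₀ (fun j => residue O ⟨y j, hy j⟩)) :
    AlgebraicIndependent κ₀ (fun j => residue O ⟨y j ^ n, hyn j⟩) := by
  have h := hri.polynomial_aeval_of_transcendental (f := fun _ => Polynomial.X ^ n)
    (fun _ => (Polynomial.transcendental_X κ₀).pow hn)
  have hres : (fun j => residue O ⟨y j ^ n, hyn j⟩) = fun j => (residue O ⟨y j, hy j⟩) ^ n := by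
    funext j
    rw [← map_pow]
    rfl
  rw [hres]
  simpa using h

/-- **`k(x, y)` is algebraic over `k(x ^ n, y ^ n)`** (`0 < n`): every element of
`Subfield.closure (k ∪ (range x ∪ range y))` is algebraic over
`Subfield.closure (k ∪ (range (x ^ n) ∪ range (y ^ n)))`, each generator being a root of
`X ^ n - c`. [folklore] -/
theorem abhTransfer_isAlgebraic_closure_pow {K : Type} [Field K] (kK : Subfield K)
    {ρ τ : ℕ} (x : Fin ρ → K) (y : Fin τ → K) {n : ℕ} (hn : 0 < n) {w : K}
    (hw : w ∈ Subfield.closure ((kK : Set K) ∪ (Set.range x ∪ Set.range y))) :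
    IsAlgebraic (Subfield.closure ((kK : Set K) ∪
      (Set.range (fun i => x i ^ n) ∪ Set.range (fun j => y j ^ n)))) w := by
  set F₁ := Subfield.closure ((kK : Set K) ∪
    (Set.range (fun i => x i ^ n) ∪ Set.range (fun j => y j ^ n))) with hF₁
  -- the generators `x i`, `y j` are algebraic over `F₁`
  have hs : ∀ z ∈ Set.range x ∪ Set.range y, IsAlgebraic F₁ z := by
    rintro z (⟨i, rfl⟩ | ⟨j, rfl⟩)
    · have hmem : x i ^ n ∈ F₁ := Subfield.subset_closure (Or.inr (Or.inl ⟨i, rfl⟩))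
      exact IsAlgebraic.of_pow hn (isAlgebraic_algebraMap (⟨x i ^ n, hmem⟩ : F₁))
    · have hmem : y j ^ n ∈ F₁ := Subfield.subset_closure (Or.inr (Or.inr ⟨j, rfl⟩))
      exact IsAlgebraic.of_pow hn (isAlgebraic_algebraMap (⟨y j ^ n, hmem⟩ : F₁))
  have hw' : w ∈ Subfield.closure ((F₁ : Set K) ∪ (Set.range x ∪ Set.range y)) := by
    refine Subfield.closure_mono ?_ hw
    exact Set.union_subset_union_left _ fun z hz => Subfield.subset_closure (Or.inl hz)
  exact isAlgebraic_of_mem_closure hs hw'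

/-! ### The stub -/

/-- **An Abhyankar place of `K/k` restricts to an Abhyankar place of `K₀ = Frac A₀`** when
`K = Frac (A₀[t])`, `t ^ p ∈ A₀`, `char k = p`: the `p`-th powers `(x^p, y^p)` of Abhyankar data
`(x, y)` of `K/k` lie in `K₀ ⊇ K^p`, keep `ℤ`-independent values and algebraically independent
residues, and `K ⊇ K₀` is algebraic over `k(x^p, y^p)`. (The hypothesis `A₀ ⊆ O` is part of the
registered signature but not needed.) [folklore] -/
theorem stub_abhyankarTransfer :
    ∀ p : ℕ, p.Prime → ∀ (k K : Type) [Field k] [CharP k p] [Field K] [Algebra k K] (O : ValuationSubring K) (A₀ : Subalgebra k K) (h₀ : A₀.toSubring ≤ O.toSubring) (t : K), t ^ p ∈ A₀ → IsFractionRing (Algebra.adjoin k (insert t (A₀ : Set K))) K → Literature.AlgebraicGeometry.Resolution.IsAbhyankarPlace O (algebraMap k K).fieldRange ⊤ → Literature.AlgebraicGeometry.Resolution.IsAbhyankarPlace O (algebraMap k K).fieldRange (Subfield.closure (A₀ : Set K)) := by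
  intro p hp k K _ _ _ _ O A₀ _ t htp hfr hA
  haveI : CharP K p := charP_of_injective_algebraMap (algebraMap k K).injective p
  set kK : Subfield K := (algebraMap k K).fieldRange with hkK
  set K₀ : Subfield K := Subfield.closure (A₀ : Set K) with hK₀
  -- `K^p ⊆ K₀`
  have hKp : ∀ z : K, z ^ p ∈ K₀ := fun z => by
    have h : z ^ p ∈ ((IntermediateField.adjoin k (A₀ : Set K) : IntermediateField k K) : Set K) :=
      torsor_pow_mem_adjoin hp A₀ t htp hfr z
    rwa [torsorExt_coe_adjoin_eq_coe_closure A₀] at h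
  obtain ⟨ρ, τ, x, y, hy, -, -, hvi, hri, halg⟩ := hA
  -- the `p`-th powers of the Abhyankar data
  have hy' : ∀ j, y j ^ p ∈ O := fun j => O.pow_mem (hy j) p
  have hvi' := abhTransfer_valIndep_pow O kK x hp.ne_zero hvi
  have hri' := abhTransfer_algIndep_residue_pow O (resField O kK) y hy hp.pos hy' hri
  refine isAbhyankarPlace_of_algebraic (V := O) (K := kK) (x := fun i => x i ^ p)
    (y := fun j => y j ^ p) hy' hvi' hri' ?_ ?_
  · -- `k(x^p, y^p) ⊆ K₀`
    refine Subfield.closure_le.mpr ?_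
    rintro z (hz | ⟨i, rfl⟩ | ⟨j, rfl⟩)
    · obtain ⟨c, rfl⟩ := RingHom.mem_fieldRange.mp hz
      exact Subfield.subset_closure (A₀.algebraMap_mem c)
    · exact hKp _
    · exact hKp _
  · -- every element of `K₀` (indeed of `K`) is algebraic over `k(x^p, y^p)`
    intro z _
    have hz : IsAlgebraic (Subfield.closure ((kK : Set K) ∪ (Set.range x ∪ Set.range y))) z :=
      (isAlgebraic_closure_iff kK _ z).mpr (halg z (Subfield.mem_top z))
    refine isAlgebraic_trans_subfield (Subfield.closure_le.mpr ?_)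
      (fun w hw => abhTransfer_isAlgebraic_closure_pow kK x y hp.pos hw) hz
    have hxF : ∀ i, x i ∈ Subfield.closure ((kK : Set K) ∪ (Set.range x ∪ Set.range y)) :=
      fun i => Subfield.subset_closure (Or.inr (Or.inl ⟨i, rfl⟩))
    have hyF : ∀ j, y j ∈ Subfield.closure ((kK : Set K) ∪ (Set.range x ∪ Set.range y)) :=
      fun j => Subfield.subset_closure (Or.inr (Or.inr ⟨j, rfl⟩))
    rintro w (hw | ⟨i, rfl⟩ | ⟨j, rfl⟩)
    · exact Subfield.subset_closure (Or.inl hw)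
    · exact Subfield.pow_mem _ (hxF i) p
    · exact Subfield.pow_mem _ (hyF j) p

end Summit.ResolutionOfSingularities.ResolutionOfSingularities.Theorems.PfaffLine
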